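import Literature.AlgebraicGeometry.HodgeTheory.WeilClassesSurfaces
import Literature.AlgebraicGeometry.HodgeTheory.WeilSurfaceSquareModel
import Literature.AlgebraicGeometry.HodgeTheory.WeilSurfaceSquareRational
import Literature.AlgebraicGeometry.HodgeTheory.ComplexConjugation
import Literature.NumberTheory.Transcendental.DeRhamTheoremProofs
import HarnessLib

/-!
# Weil-type abelian surfaces exist for every `ℚ(√-d)` (discharge of `exists_weilType_abelianSurfaces`)

The named fact `Literature.AlgebraicGeometry.HodgeTheory.exists_weilType_abelianSurfaces`
(`WeilClassesSurfaces.lean`; Schoen, Compositio 114 (1998) §10, van Geemen LNM 1594 5.3, Markman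
arXiv:2509.23403 §11.5 Step 2): for every `d ≥ 1` there is a complex abelian surface `B` with an
endomorphism `ψ`, `ψ ∘ ψ = -d`, and a NON-ZERO RATIONAL class `b` of Hodge type `(1,1)` in the Weil
plane `weilClassesOf B ψ 1 d ⊆ H²(B(ℂ); ℂ)`. This file PROVES it (`exists_weilType_abelianSurfaces_holds`)
on the tree's real carriers, with the COMPANION surface instead of Schoen's CM surface:

* `B = E × E`, `E = E_i` the Weierstrass cubic of `ℤ + iℤ` (any lattice would do) as an abelian variety,
  `ψ = ((0, -d), (1, 0))` (`WeilSquare.square`, `WeilSquare.psi`, file `WeilSurfaceSquareModel`);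
* the Hodge model of `B` with carrier the torus `T = ℂ²/(ℤ + iℤ)²` (`WeilSquare.torusMap` is an
  analytification), comparison a natural complex de Rham family `e` (de Rham's theorem
  `exists_complexDeRhamIsoFamily_holds`, PROVED in the tree) and the Hodge decomposition of the torus
  (`ComplexTorus.isInternal_hodgePQ`) — `WeilSquare.hodgeModel`;
* `b = (φ^*)⁻¹(c · e[dx₀ ∧ dx₁ - d · dx₂ ∧ dx₃])` (on `E × E`: a multiple of `[o × E] - d [E × o]`), which
  is RATIONAL (`WeilSquare.exists_smul_deRhamBasis_isRationalClass`: `c · e[dx_a ∧ dx_b]` are rational),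
  NON-ZERO (basis vectors), of TYPE `(1,1)` and the sum `b = b₊ + b₋` of the classes of the Weil forms
  `α_{± i√d}` (`weilForm_add_weilForm_neg`), which lie in `weilClassesPlus/Minus`: the test endomorphism
  `x + yψ` is `mapMatrix (weilMatrix d x y)` on `T` (`torusMap_mapMatrix`), under which `e[α_s]` is
  multiplied by `(x + ys)²` (naturality of `e`, `cmap_cconstClass_weilForm`).

No named fact is introduced; the discharge relies on nothing unproved.

## References

* C. Schoen, Compositio Math. 114 (1998), §10 (proof of the Proposition, p. 333). [Schoen1998HodgeWeilAddendum]
* B. van Geemen, LNM 1594 (1994), 5.2–5.3 and Lemma 5.2 (6). [vanGeemen1994HodgeAV]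
* E. Markman, arXiv:2509.23403, §11.5 Step 2. [Markman2025SurveySecant]
* H. Lange, Ch. Birkenhake, *Complex Abelian Varieties* (1992), §1.1. [LangeBirkenhake1992]
-/

noncomputable section

open CategoryTheory
open scoped Manifold ContDiff ComplexConjugate
open Literature.AlgebraicGeometry.Motives Literature.Geometry.Kaehler Literature.NumberTheory.Transcendental
open Literature.AlgebraicTopology.SingularHomology

namespace Literature.AlgebraicGeometry.HodgeTheory

namespace WeilSquare

section Model

variable (τ : ℂ) (hτ : τ.im ≠ 0) (e : ComplexDeRhamIsoFamily (Fin 2 → ℂ)) (he : e.IsNatural)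

/-- **The Hodge model of `E_τ × E_τ` with carrier the torus `ℂ²/(ℤ + τℤ)²`**: comparison map
`torusMap` (an analytification), de Rham comparison `e`, Hodge decomposition of the torus.
[cite: LangeBirkenhake1992, §1.1.5 Prop. 1.1.23] [cite: SerreGAGA1956, §2] -/
abbrev hodgeModel : HodgeModel 2 (square τ hτ).X where
  model := Fin 2 → ℂ
  carrier := Torus τ hτ
  toComplexPoints := torusMap τ hτ
  isAnalytification := isAnalytification_torusMap τ hτ
  deRham := e
  deRham_isNatural := he
  isInternal_hodgePQ := ComplexTorus.isInternal_hodgePQ (periodIso τ hτ)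

/-- The pull-back `φ^* : H²((E × E)(ℂ); ℂ) → H²(T_τ; ℂ)` along `torusMap`. [cite: SerreGAGA1956, §2] -/
def pullbackHom : complexBetti (square τ hτ).X 2 →ₗ[ℂ] singularCohomology ℂ ℂ (Torus τ hτ) 2 :=
  (singularCohomology.map ℂ ℂ ⟨torusMap τ hτ, (isHomeomorph_torusMap τ hτ).continuous⟩ 2).hom

/-- The model's pull-back in degree `2` is `pullbackHom`. [folklore] -/
theorem hodgeModel_pullback (x : complexBetti (square τ hτ).X 2) :
    (hodgeModel τ hτ e he).pullback 2 x = pullbackHom τ hτ x := rfl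

/-- The inverse of `φ^*` (`torusMap` is a homeomorphism). [cite: SerreGAGA1956, §2] -/
def pullbackInv : singularCohomology ℂ ℂ (Torus τ hτ) 2 →ₗ[ℂ] complexBetti (square τ hτ).X 2 :=
  (singularCohomology.map ℂ ℂ ⟨(isHomeomorph_torusMap τ hτ).homeomorph.symm,
    (isHomeomorph_torusMap τ hτ).homeomorph.symm.continuous⟩ 2).hom

/-- `φ^* ∘ (φ^*)⁻¹ = id`. [cite: HatcherAT2002, §3.1] -/
theorem pullbackHom_pullbackInv (y : singularCohomology ℂ ℂ (Torus τ hτ) 2) :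
    pullbackHom τ hτ (pullbackInv τ hτ y) = y := by
  have h : (⟨(isHomeomorph_torusMap τ hτ).homeomorph.symm,
      (isHomeomorph_torusMap τ hτ).homeomorph.symm.continuous⟩ : C(_, _)).comp
      ⟨torusMap τ hτ, (isHomeomorph_torusMap τ hτ).continuous⟩ = ContinuousMap.id _ :=
    ContinuousMap.ext fun x ↦ (isHomeomorph_torusMap τ hτ).homeomorph.symm_apply_apply x
  change (singularCohomology.map ℂ ℂ ⟨torusMap τ hτ, (isHomeomorph_torusMap τ hτ).continuous⟩ 2).hom
    ((singularCohomology.map ℂ ℂ ⟨(isHomeomorph_torusMap τ hτ).homeomorph.symm,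
      (isHomeomorph_torusMap τ hτ).homeomorph.symm.continuous⟩ 2).hom y) = y
  rw [← LinearMap.comp_apply, ← ModuleCat.hom_comp, ← singularCohomology.map_comp, h,
    singularCohomology.map_id, ModuleCat.hom_id, LinearMap.id_apply]

/-- `(φ^*)⁻¹ ∘ φ^* = id`. [cite: HatcherAT2002, §3.1] -/
theorem pullbackInv_pullbackHom (x : complexBetti (square τ hτ).X 2) :
    pullbackInv τ hτ (pullbackHom τ hτ x) = x := by
  have h : (⟨torusMap τ hτ, (isHomeomorph_torusMap τ hτ).continuous⟩ : C(_, _)).comp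
      ⟨(isHomeomorph_torusMap τ hτ).homeomorph.symm, (isHomeomorph_torusMap τ hτ).homeomorph.symm.continuous⟩ =
      ContinuousMap.id _ :=
    ContinuousMap.ext fun x ↦ (isHomeomorph_torusMap τ hτ).homeomorph.apply_symm_apply x
  change (singularCohomology.map ℂ ℂ ⟨(isHomeomorph_torusMap τ hτ).homeomorph.symm,
      (isHomeomorph_torusMap τ hτ).homeomorph.symm.continuous⟩ 2).hom
    ((singularCohomology.map ℂ ℂ ⟨torusMap τ hτ, (isHomeomorph_torusMap τ hτ).continuous⟩ 2).hom x) = x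
  rw [← LinearMap.comp_apply, ← ModuleCat.hom_comp, ← singularCohomology.map_comp, h,
    singularCohomology.map_id, ModuleCat.hom_id, LinearMap.id_apply]

/-- `(φ^*)⁻¹` is injective. [folklore] -/
theorem pullbackInv_injective : Function.Injective (pullbackInv τ hτ) := fun y y' h ↦ by
  rw [← pullbackHom_pullbackInv τ hτ y, ← pullbackHom_pullbackInv τ hτ y', h]

/-- `φ^*` is injective. [folklore] -/
theorem pullbackHom_injective : Function.Injective (pullbackHom τ hτ) := fun x x' h ↦ by
  rw [← pullbackInv_pullbackHom τ hτ x, ← pullbackInv_pullbackHom τ hτ x', h]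

/-- **The test endomorphisms on cohomology, transported to the torus**: for every class `w` on
`(E × E)(ℂ)`, `φ^*((x + yψ)^* w) = (mapMatrix A)^*(φ^* w)` with `A = weilMatrix d x y`
(`torusMap_mapMatrix`). [cite: LangeBirkenhake1992, §1.1.2] -/
theorem pullbackHom_map_weilEnd (d x y : ℕ) (w : complexBetti (square τ hτ).X 2) :
    pullbackHom τ hτ (singularCohomology.map ℂ ℂ
        (AlgPoints.mapContinuous (L := ℂ) (x • 𝟙 (square τ hτ) + y • psi τ hτ d).hom.hom.hom) 2 w) =
      torusPullback τ hτ (weilMatrix d x y) (pullbackHom τ hτ w) := by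
  have hc : (AlgPoints.mapContinuous (L := ℂ) (x • 𝟙 (square τ hτ) + y • psi τ hτ d).hom.hom.hom).comp
      (⟨torusMap τ hτ, (isHomeomorph_torusMap τ hτ).continuous⟩ : C(_, _)) =
      (⟨torusMap τ hτ, (isHomeomorph_torusMap τ hτ).continuous⟩ : C(_, _)).comp
        ⟨ComplexTorus.mapMatrix (periodIso τ hτ) (periodIso τ hτ) (weilMatrix d x y),
          (ComplexTorus.contMDiff_real_mapMatrix (Φ := periodIso τ hτ) (Φ' := periodIso τ hτ)
            (n := ∞) (weilMatrix d x y)).continuous⟩ := by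
    refine ContinuousMap.ext fun t ↦ ?_
    simp only [ContinuousMap.comp_apply, ContinuousMap.coe_mk, AlgPoints.mapContinuous_apply]
    exact (torusMap_mapMatrix τ hτ d x y t).symm
  change (singularCohomology.map ℂ ℂ ⟨torusMap τ hτ, _⟩ 2).hom ((singularCohomology.map ℂ ℂ _ 2).hom w) = _
  rw [← LinearMap.comp_apply, ← ModuleCat.hom_comp, ← singularCohomology.map_comp, hc,
    singularCohomology.map_comp, torusPullback_apply]
  rfl

end Model

/-! ### The Weil classes of the companion surface -/

section Classes

variable (τ : ℂ) (hτ : τ.im ≠ 0) {e : ComplexDeRhamIsoFamily (Fin 2 → ℂ)} (he : e.IsNatural)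

include he in
/-- `(mapMatrix A)^*(e[α_s]) = (x + ys)² e[α_s]` on `H²(T_τ; ℂ)` for `s² = -d`, `A = weilMatrix d x y`.
[cite: vanGeemen1994HodgeAV, 5.2] -/
theorem torusPullback_weilFormClass (d x y : ℤ) {s : ℂ} (hs : s * s = -d) :
    torusPullback τ hτ (weilMatrix d x y) (deRhamIso τ hτ e (ComplexTorus.cconstClass (periodIso τ hτ) (weilForm s))) =
      ((x : ℂ) + y * s) ^ 2 • deRhamIso τ hτ e (ComplexTorus.cconstClass (periodIso τ hτ) (weilForm s)) := by
  rw [torusPullback_deRhamIso τ hτ he, cmap_cconstClass_weilForm τ hτ d x y hs, map_smul]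

include he in
/-- **The eigen-components are Weil eigenclasses**: for `s² = -d` and every `x, y ∈ ℕ`, the class
`(φ^*)⁻¹(a · e[α_s])` on `E × E` is an eigenvector of `(x + yψ)^*` with eigenvalue `(x + ys)²`.
[cite: vanGeemen1994HodgeAV, 5.2] -/
theorem map_weilEnd_pullbackInv_weilFormClass (d x y : ℕ) {s : ℂ} (hs : s * s = -(d : ℂ)) (a : ℂ) :
    singularCohomology.map ℂ ℂ
        (AlgPoints.mapContinuous (L := ℂ) (x • 𝟙 (square τ hτ) + y • psi τ hτ d).hom.hom.hom) 2
        (pullbackInv τ hτ (a • deRhamIso τ hτ e (ComplexTorus.cconstClass (periodIso τ hτ) (weilForm s)))) =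
      ((x : ℂ) + y * s) ^ 2 •
        pullbackInv τ hτ (a • deRhamIso τ hτ e (ComplexTorus.cconstClass (periodIso τ hτ) (weilForm s))) := by
  have hs' : s * s = -((d : ℤ) : ℂ) := by rw [Int.cast_natCast]; exact hs
  set X := deRhamIso τ hτ e (ComplexTorus.cconstClass (periodIso τ hτ) (weilForm s)) with hX
  have key : torusPullback τ hτ (weilMatrix d x y) (a • X) = (((x : ℤ) : ℂ) + (y : ℤ) * s) ^ 2 • (a • X) := by
    rw [LinearMap.map_smul, hX, torusPullback_weilFormClass τ hτ he (d : ℤ) x y hs', smul_comm]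
  have h := pullbackHom_map_weilEnd τ hτ d x y (pullbackInv τ hτ (a • X))
  rw [pullbackHom_pullbackInv, key] at h
  have h2 : (((x : ℤ) : ℂ) + (y : ℤ) * s) ^ 2 • (a • X) =
      pullbackHom τ hτ ((((x : ℤ) : ℂ) + (y : ℤ) * s) ^ 2 • pullbackInv τ hτ (a • X)) := by
    rw [LinearMap.map_smul, pullbackHom_pullbackInv]
  rw [h2] at h
  have h3 := pullbackHom_injective τ hτ h
  simpa only [Int.cast_natCast] using h3

end Classes

end WeilSquare

/-! ### The discharge -/

open WeilSquare in
/-- **Abelian surfaces of Weil type exist for every `K = ℚ(√-d)` — discharge of the named fact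
`exists_weilType_abelianSurfaces`.** For every `d ≥ 1`: `B = E_i × E_i` (`E_i` the Weierstrass cubic
of `ℤ + iℤ` as an abelian variety), `ψ = ((0, -d), (1, 0))` the companion endomorphism (`ψ² = -d`), and
`b = (φ^*)⁻¹(c · e[dx₀ ∧ dx₁ - d · dx₂ ∧ dx₃])` on the analytification `φ : ℂ²/(ℤ + iℤ)² ≅ B(ℂ)`: a
non-zero rational class of Hodge type `(1,1)`, equal to the sum of the classes of the Weil forms
`α_{± i√d}`, which are simultaneous eigenclasses of all `(x + yψ)^*` with eigenvalues `(x ± iy√d)²`.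
(Schoen takes `E` with CM by `ℤ[√-d]` and `ψ = √-d × (-√-d)`; the companion matrix makes the CM
unnecessary.) Relies on: nothing unproved. [cite: Schoen1998HodgeWeilAddendum, §10 (proof of the Proposition, p. 333)]
[cite: vanGeemen1994HodgeAV, 5.3 and Lemma 5.2 (6)] [cite: Markman2025SurveySecant, §11.5 Step 2] -/
theorem exists_weilType_abelianSurfaces_holds : exists_weilType_abelianSurfaces := by
  intro d hd
  -- the lattice `ℤ + iℤ`, the surface, the companion endomorphism
  have hτ : Complex.I.im ≠ 0 := by simp
  obtain ⟨e, he⟩ := exists_complexDeRhamIsoFamily_holds (Fin 2 → ℂ)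
  set Φ := periodIso Complex.I hτ with hΦ
  -- the scalar of the rational structure
  obtain ⟨c, hc, hrat, -⟩ := exists_smul_deRhamBasis_isRationalClass Complex.I hτ he
  -- `s = i√d`, `s² = -d`
  set s : ℂ := Complex.I * (Real.sqrt d : ℂ) with hsdef
  have hsq : ((Real.sqrt d : ℝ) : ℂ) * (Real.sqrt d : ℂ) = (d : ℂ) := by
    rw [← Complex.ofReal_mul, Real.mul_self_sqrt (Nat.cast_nonneg d), Complex.ofReal_natCast]
  have hs : s * s = -(d : ℂ) := by
    rw [hsdef]; linear_combination ((Real.sqrt d : ℂ) * (Real.sqrt d : ℂ)) * Complex.I_mul_I - hsq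
  have hs' : (-s) * (-s) = -(d : ℂ) := by rw [neg_mul_neg, hs]
  have hsZ : s * s = -((d : ℤ) : ℂ) := by rw [Int.cast_natCast]; exact hs
  -- the classes on the torus
  set Ap := deRhamIso Complex.I hτ e (ComplexTorus.cconstClass Φ (weilForm s)) with hAp
  set Am := deRhamIso Complex.I hτ e (ComplexTorus.cconstClass Φ (weilForm (-s))) with hAm
  set β := ComplexTorus.latMonomial Φ 2 ![0, 1] - ((d : ℤ) : ℂ) • ComplexTorus.latMonomial Φ 2 ![2, 3] with hβ
  set Bt := deRhamIso Complex.I hτ e (ComplexTorus.cconstClass Φ β) with hBt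
  have hconj : conj Complex.I - Complex.I = -2 * Complex.I := by rw [Complex.conj_I]; ring
  set k : ℂ := (2 * (conj Complex.I - Complex.I))⁻¹ with hk
  have hk0 : 2 * (conj Complex.I - Complex.I) ≠ 0 := by
    rw [hconj]; exact mul_ne_zero two_ne_zero (mul_ne_zero (by norm_num) Complex.I_ne_zero)
  have hβk : β = k • (weilForm s + weilForm (-s)) := by
    rw [weilForm_add_weilForm_neg Complex.I hτ (d : ℤ) hsZ, smul_smul, hk, inv_mul_cancel₀ hk0, one_smul]
  have hBt_eq : Bt = k • (Ap + Am) := by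
    rw [hBt, hβk, map_smul, map_add, map_smul, map_add]
  -- the classes on `E × E`
  set b := pullbackInv Complex.I hτ (c • Bt) with hb
  set bp := pullbackInv Complex.I hτ ((c * k) • Ap) with hbp
  set bm := pullbackInv Complex.I hτ ((c * k) • Am) with hbm
  have hbsum : b = bp + bm := by
    rw [hb, hbp, hbm, ← map_add, hBt_eq, smul_smul, smul_add]
  refine ⟨square Complex.I hτ, psi Complex.I hτ d, b, dim_square Complex.I hτ, psi_comp_psi Complex.I hτ d,
    ?_, ?_, ?_, ?_⟩
  · -- `b ≠ 0`: `c ≠ 0`, `(φ^*)⁻¹` injective and `e[β] = (basis 0) - d (basis 5) ≠ 0`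
    intro h0
    have h1 : c • Bt = 0 := pullbackInv_injective Complex.I hτ (by rw [← hb, h0, map_zero])
    have h2 : Bt = 0 := (smul_eq_zero.mp h1).resolve_left hc
    have hrepr := congrArg (fun v ↦ (singBasis Complex.I hτ e).repr v 0) h2
    simp only [map_zero, Finsupp.zero_apply] at hrepr
    have hB : Bt = singBasis Complex.I hτ e 0 - ((d : ℤ) : ℂ) • singBasis Complex.I hτ e 5 := by
      rw [hBt, hβ, singBasis_apply, singBasis_apply, deRhamBasis_apply, deRhamBasis_apply, map_sub,
        map_smul, map_sub, map_smul]
      rfl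
    rw [hB, map_sub, map_smul, Module.Basis.repr_self, Module.Basis.repr_self, Finsupp.sub_apply,
      Finsupp.smul_apply, Finsupp.single_eq_same, Finsupp.single_eq_of_ne (by decide)] at hrepr
    norm_num at hrepr
  · -- rational: `c • e[dx₀₁] - d • (c • e[dx₂₃])`
    have h0 := hrat 0
    have h5 := hrat 5
    rw [deRhamBasis_apply] at h0 h5
    have hcB : c • Bt = c • deRhamIso Complex.I hτ e (ComplexTorus.cconstClass Φ (ComplexTorus.latMonomial Φ 2 (sqWord 0))) +
        (((-(d : ℤ) : ℤ) : ℚ) : ℂ) • (c • deRhamIso Complex.I hτ e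
          (ComplexTorus.cconstClass Φ (ComplexTorus.latMonomial Φ 2 (sqWord 5)))) := by
      rw [hBt, hβ, map_sub, map_smul, map_sub, map_smul, smul_sub, Rat.cast_intCast, Int.cast_neg, neg_smul,
        smul_comm c, ← sub_eq_add_neg]
      rfl
    rw [hb, hcB]
    exact (h0.add (h5.smul _)).map _
  · -- Hodge type `(1,1)` in the torus model
    refine ⟨hodgeModel Complex.I hτ e he, ?_⟩
    rw [hodgeModel_pullback, hb, pullbackHom_pullbackInv, hBt_eq, smul_smul]
    change (c * k) • (Ap + Am) ∈ (hodgePQ (Fin 2 → ℂ) (Torus Complex.I hτ) 2 1 1).map (deRhamIso Complex.I hτ e).toLinearMap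
    refine Submodule.smul_mem _ _ (Submodule.add_mem _ ?_ ?_)
    · exact Submodule.mem_map_of_mem (cconstClass_weilForm_mem_hodgePQ Complex.I hτ s)
    · exact Submodule.mem_map_of_mem (cconstClass_weilForm_mem_hodgePQ Complex.I hτ (-s))
  · -- the Weil plane: `b = b₊ + b₋`
    rw [hbsum, weilClassesOf]
    refine Submodule.add_mem _ (Submodule.mem_sup_left ?_) (Submodule.mem_sup_right ?_)
    · rw [mem_weilClassesPlus_iff]
      intro x y
      have h := map_weilEnd_pullbackInv_weilFormClass Complex.I hτ he d x y hs (c * k)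
      have hev : ((x : ℂ) + y * s) ^ 2 = ((x : ℂ) + (y : ℂ) * Complex.I * (Real.sqrt d : ℂ)) ^ (2 * 1) := by
        rw [hsdef]; ring
      rw [← hev]
      exact h
    · rw [mem_weilClassesMinus_iff]
      intro x y
      have h := map_weilEnd_pullbackInv_weilFormClass Complex.I hτ he d x y hs' (c * k)
      have hev : ((x : ℂ) + y * (-s)) ^ 2 = ((x : ℂ) - (y : ℂ) * Complex.I * (Real.sqrt d : ℂ)) ^ (2 * 1) := by
        rw [hsdef]; ring
      rw [← hev]
      exact h

end Literature.AlgebraicGeometry.HodgeTheory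

end
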